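import Literature.MathematicalPhysics.QuantumLattice.PairCorrelations
import Literature.MathematicalPhysics.QuantumLattice.HubbardParityGapDoublonDeficit
import Literature.MathematicalPhysics.QuantumLattice.HubbardGaugeBound
import Literature.MathematicalPhysics.QuantumLattice.HubbardSzSectorLadder
import HarnessLib

/-!
# Singlet pair order is bounded by the minority-spin population

Obstruction report, Theorem 14(a) (requirement R9; the SU(2) transfer and the summit consequence
are in `SoloBlindSpinPolarization`).

The pair field `Δ_g = Σ_x P_x` on the torus of side `L` is a sum of SINGLET pairs
`(g e/√2)(c_{x↑} c_{x+e,↓} - c_{x↓} c_{x+e,↑})`; every term removes one down electron, and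
`‖c_{·↑}‖ ≤ 1`. Hence for every vector `φ` of the coordinate sector `(N↑, N↓) = (a, b)`

  `re ⟨φ, Δ_gᴴ Δ_g φ⟩ = ‖Δ_g φ‖² ≤ (2 Σ_e |g e/√2|)² · L² · b · ‖φ‖²`   (`≤ 32 L² b ‖φ‖²` for d-wave):

`‖Δ_g φ‖ ≤ Σ_{x,e} |g e/√2| (‖c_{x+e,↓} φ‖ + ‖c_{x,↓} φ‖) = 2 Σ_e |g e/√2| · Σ_y ‖c_{y↓} φ‖`
(translation invariance of the site sum) and, by Cauchy–Schwarz,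
`(Σ_y ‖c_{y↓} φ‖)² ≤ L² Σ_y ‖c_{y↓} φ‖² = L² re ⟨φ, N_↓ φ⟩ = L² b ‖φ‖²`.

Contents: the Euclidean norm `enorm` of a Fock vector and its elementary properties;
`enorm_localPair_mulVec_le`, `enorm_pairField_mulVec_le`, `sum_downAmp_sq`,
`re_expect_pairField_le_minority` (general form factor), `dWave_coupling_sq_le`
(`(2Σ_e|g_d(e)/√2|)² ≤ 32`), `re_expect_dWave_le_minority`.

References: D. J. Scalapino, Phys. Rep. 250 (1995) 329, §2 (the singlet pair field);
E. H. Lieb, Phys. Rev. Lett. 62 (1989) 1201 (sectors `(N↑, N↓)`). Tags: [folklore].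
-/

namespace Summit.HubbardSuperconductivity.HubbardSuperconductivity.Theorems.SpinPolarization

open Matrix Finset Literature.MathematicalPhysics.QuantumLattice HubbardWave0
  Literature.Probability.LatticeModels
open Literature.MathematicalPhysics.QuantumLattice.LiebThm1
open scoped ComplexOrder Matrix.Norms.L2Operator

-- file-local, as in the sibling `SoloBlind*` files
attribute [-instance] instDecidableEqLex

/-! ### Euclidean norm of Fock vectors -/

section Enorm

variable {n : Type*} [Fintype n]

/-- The Euclidean (`ℓ²`) norm of a coordinate vector. [folklore] -/
noncomputable def enorm (v : n → ℂ) : ℝ := ‖(WithLp.toLp 2 v : EuclideanSpace ℂ n)‖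

/-- `0 ≤ ‖v‖₂`. [folklore] -/
theorem enorm_nonneg (v : n → ℂ) : 0 ≤ enorm v := norm_nonneg _

/-- `‖v‖₂² = re ⟨v, v⟩`. [folklore] -/
theorem enorm_sq_eq_re (v : n → ℂ) : enorm v ^ 2 = (star v ⬝ᵥ v).re :=
  ThermodynamicLimit.norm_toLp_sq v

/-- Triangle inequality. [folklore] -/
theorem enorm_add_le (v w : n → ℂ) : enorm (v + w) ≤ enorm v + enorm w := by
  unfold enorm; rw [WithLp.toLp_add]; exact norm_add_le _ _

/-- `‖v - w‖₂ ≤ ‖v‖₂ + ‖w‖₂`. [folklore] -/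
theorem enorm_sub_le (v w : n → ℂ) : enorm (v - w) ≤ enorm v + enorm w := by
  unfold enorm; rw [WithLp.toLp_sub]; exact norm_sub_le _ _

/-- `‖-v‖₂ = ‖v‖₂`. [folklore] -/
theorem enorm_neg (v : n → ℂ) : enorm (-v) = enorm v := by
  unfold enorm; rw [WithLp.toLp_neg]; exact norm_neg _

/-- `‖c • v‖₂ = |c| ‖v‖₂`. [folklore] -/
theorem enorm_smul (c : ℂ) (v : n → ℂ) : enorm (c • v) = ‖c‖ * enorm v := by
  unfold enorm; rw [WithLp.toLp_smul]; exact norm_smul _ _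

/-- `‖0‖₂ = 0`. [folklore] -/
theorem enorm_zero : enorm (0 : n → ℂ) = 0 := by
  unfold enorm; rw [WithLp.toLp_zero]; exact norm_zero

/-- `‖Σ fᵢ‖₂ ≤ Σ ‖fᵢ‖₂`. [folklore] -/
theorem enorm_sum_le {ι : Type*} (s : Finset ι) (f : ι → n → ℂ) :
    enorm (∑ i ∈ s, f i) ≤ ∑ i ∈ s, enorm (f i) := by
  classical
  induction s using Finset.induction_on with
  | empty => simp [enorm_zero]
  | insert a s ha ih =>
    rw [Finset.sum_insert ha, Finset.sum_insert ha]
    exact (enorm_add_le _ _).trans (by linarith)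

variable [DecidableEq n]

/-- `‖A v‖₂ ≤ ‖A‖ ‖v‖₂`. [folklore] -/
theorem enorm_mulVec_le (A : Matrix n n ℂ) (v : n → ℂ) : enorm (A *ᵥ v) ≤ ‖A‖ * enorm v :=
  ThermodynamicLimit.norm_toLp_mulVec_le A v

omit [DecidableEq n] in
/-- `‖A v‖₂² = re ⟨v, Aᴴ A v⟩`. [folklore] -/
theorem enorm_mulVec_sq (A : Matrix n n ℂ) (v : n → ℂ) :
    enorm (A *ᵥ v) ^ 2 = (star v ⬝ᵥ (Aᴴ * A) *ᵥ v).re := by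
  rw [enorm_sq_eq_re, star_mulVec, ← dotProduct_mulVec, mulVec_mulVec]

end Enorm

/-! ### (a) The minority bound -/

section Minority

variable (g : Site 2 → ℝ) {L : ℕ} [NeZero L]

/-- The down-electron amplitude at the torus site `y`: `u(y) = ‖c_{y↓} φ‖₂`. [folklore] -/
noncomputable def downAmp (φ : Fock (Orb (FermionTorus 2 L))) (y : TorusSite 2 L) : ℝ :=
  enorm (annihilation (orb (FermionTorus.ofTorusSite y) 1) *ᵥ φ)

/-- `0 ≤ u(y)`. [folklore] -/
theorem downAmp_nonneg (φ : Fock (Orb (FermionTorus 2 L))) (y : TorusSite 2 L) : 0 ≤ downAmp φ y :=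
  enorm_nonneg _

/-- `‖P_x φ‖ ≤ Σ_e |g e/√2| (‖c_{x+e,↓} φ‖ + ‖c_{x↓} φ‖)`: each singlet term removes a down electron,
and `‖c_{·↑}‖ ≤ 1`. [folklore] -/
theorem enorm_localPair_mulVec_le (x : TorusSite 2 L) (φ : Fock (Orb (FermionTorus 2 L))) :
    enorm (localPair g L x *ᵥ φ) ≤
      ∑ e ∈ insert (0 : Site 2) unitSteps, |g e / Real.sqrt 2| *
        (downAmp φ (x + Torus.proj L e) + downAmp φ x) := by
  rw [localPair, Matrix.sum_mulVec]
  refine (enorm_sum_le _ _).trans (Finset.sum_le_sum fun e _ => ?_)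
  rw [Matrix.smul_mulVec, enorm_smul, Complex.norm_real, Real.norm_eq_abs, Matrix.sub_mulVec]
  refine mul_le_mul_of_nonneg_left ((enorm_sub_le _ _).trans (add_le_add ?_ ?_)) (abs_nonneg _)
  · -- `‖c_{x↑} (c_{x+e,↓} φ)‖ ≤ ‖c_{x+e,↓} φ‖`
    rw [← mulVec_mulVec]
    refine (enorm_mulVec_le _ _).trans ?_
    calc _ ≤ 1 * downAmp φ (x + Torus.proj L e) :=
          mul_le_mul_of_nonneg_right (norm_annihilation_le_one _) (enorm_nonneg _)
      _ = _ := one_mul _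
  · -- `c_{x↓} c_{x+e,↑} = - c_{x+e,↑} c_{x↓}`
    rw [annihilation_mul_annihilation_eq_neg, Matrix.neg_mulVec, enorm_neg, ← mulVec_mulVec]
    refine (enorm_mulVec_le _ _).trans ?_
    calc _ ≤ 1 * downAmp φ x :=
          mul_le_mul_of_nonneg_right (norm_annihilation_le_one _) (enorm_nonneg _)
      _ = _ := one_mul _

/-- `‖Δ_g φ‖ ≤ 2 Σ_e |g e/√2| · Σ_y ‖c_{y↓} φ‖` (translation invariance of the site sum). [folklore] -/
theorem enorm_pairField_mulVec_le (φ : Fock (Orb (FermionTorus 2 L))) :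
    enorm (pairField g L *ᵥ φ) ≤
      (2 * ∑ e ∈ insert (0 : Site 2) unitSteps, |g e / Real.sqrt 2|) *
        ∑ y : TorusSite 2 L, downAmp φ y := by
  rw [pairField, Matrix.sum_mulVec]
  refine (enorm_sum_le _ _).trans ?_
  calc ∑ x : TorusSite 2 L, enorm (localPair g L x *ᵥ φ)
      ≤ ∑ x : TorusSite 2 L, ∑ e ∈ insert (0 : Site 2) unitSteps, |g e / Real.sqrt 2| *
          (downAmp φ (x + Torus.proj L e) + downAmp φ x) :=
        Finset.sum_le_sum fun x _ => enorm_localPair_mulVec_le g x φ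
    _ = ∑ e ∈ insert (0 : Site 2) unitSteps, |g e / Real.sqrt 2| *
          (∑ x : TorusSite 2 L, downAmp φ (x + Torus.proj L e) + ∑ x : TorusSite 2 L, downAmp φ x) := by
        rw [Finset.sum_comm]
        refine Finset.sum_congr rfl fun e _ => ?_
        rw [← Finset.mul_sum, Finset.sum_add_distrib]
    _ = ∑ e ∈ insert (0 : Site 2) unitSteps, |g e / Real.sqrt 2| *
          (2 * ∑ x : TorusSite 2 L, downAmp φ x) := by
        refine Finset.sum_congr rfl fun e _ => ?_
        rw [Fintype.sum_equiv (Equiv.addRight (Torus.proj L e))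
          (fun x => downAmp φ (x + Torus.proj L e)) (downAmp φ) (fun x => rfl), two_mul]
    _ = _ := by rw [← Finset.sum_mul]; ring

/-- `Σ_y ‖c_{y↓} φ‖² = b ‖φ‖²` on the sector `(a, b)` (`Σ_y n_{y↓} = N_↓ = b`). [folklore] -/
theorem sum_downAmp_sq {a b : ℕ} {φ : Fock (Orb (FermionTorus 2 L))} (hφ : IsInSector a b φ) :
    ∑ y : TorusSite 2 L, downAmp φ y ^ 2 = b * enorm φ ^ 2 := by
  have h1 : ∀ y : TorusSite 2 L, downAmp φ y ^ 2 =
      (star φ ⬝ᵥ numberOp (FermionTorus.ofTorusSite y) 1 *ᵥ φ).re := by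
    intro y
    rw [downAmp, enorm_mulVec_sq, annihilation_conjTranspose]
    rfl
  simp_rw [h1]
  rw [Fintype.sum_equiv (FermionTorus.equivTorusSite (d := 2) (L := L)).symm
      (fun y => (star φ ⬝ᵥ numberOp (FermionTorus.ofTorusSite y) 1 *ᵥ φ).re)
      (fun z => (star φ ⬝ᵥ numberOp z 1 *ᵥ φ).re) (fun y => rfl),
    ← Complex.re_sum, ← dotProduct_sum, ← Matrix.sum_mulVec,
    sum_numberOp_down_mulVec_of_isInSector hφ, dotProduct_smul, smul_eq_mul, Complex.mul_re,
    enorm_sq_eq_re]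
  simp

/-- **(a) The minority bound**: on the sector `(N↑, N↓) = (a, b)`,
`re ⟨φ, Δ_gᴴ Δ_g φ⟩ ≤ (2 Σ_e |g e/√2|)² · L² · b · re ⟨φ, φ⟩`. [folklore] -/
theorem re_expect_pairField_le_minority {a b : ℕ} {φ : Fock (Orb (FermionTorus 2 L))}
    (hφ : IsInSector a b φ) :
    (star φ ⬝ᵥ ((pairField g L)ᴴ * pairField g L) *ᵥ φ).re ≤
      (2 * ∑ e ∈ insert (0 : Site 2) unitSteps, |g e / Real.sqrt 2|) ^ 2 * (L : ℝ) ^ 2 * b *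
        (star φ ⬝ᵥ φ).re := by
  set K := 2 * ∑ e ∈ insert (0 : Site 2) unitSteps, |g e / Real.sqrt 2| with hK
  have hK0 : 0 ≤ K := by positivity
  have hT0 : 0 ≤ ∑ y : TorusSite 2 L, downAmp φ y := Finset.sum_nonneg fun y _ => downAmp_nonneg φ y
  rw [← enorm_mulVec_sq, ← enorm_sq_eq_re]
  calc enorm (pairField g L *ᵥ φ) ^ 2
      ≤ (K * ∑ y : TorusSite 2 L, downAmp φ y) ^ 2 :=
        pow_le_pow_left₀ (enorm_nonneg _) (enorm_pairField_mulVec_le g φ) 2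
    _ = K ^ 2 * (∑ y : TorusSite 2 L, downAmp φ y) ^ 2 := by ring
    _ ≤ K ^ 2 * ((Finset.univ : Finset (TorusSite 2 L)).card * ∑ y : TorusSite 2 L, downAmp φ y ^ 2) :=
        mul_le_mul_of_nonneg_left (sq_sum_le_card_mul_sum_sq (s := Finset.univ) (f := downAmp φ))
          (sq_nonneg _)
    _ = K ^ 2 * (L : ℝ) ^ 2 * b * enorm φ ^ 2 := by
        have hcard : Fintype.card (TorusSite 2 L) = L ^ 2 := by
          simp [TorusSite, ZMod.card]
        rw [sum_downAmp_sq hφ, Finset.card_univ, hcard]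
        push_cast
        ring

/-- `(2 Σ_e |g_d(e)/√2|)² ≤ 32`. [folklore] -/
theorem dWave_coupling_sq_le :
    (2 * ∑ e ∈ insert (0 : Site 2) unitSteps, |dWaveFormFactor e / Real.sqrt 2|) ^ 2 ≤ 32 := by
  have hs2 : (0 : ℝ) < Real.sqrt 2 := Real.sqrt_pos.2 (by norm_num)
  have hsum : ∑ e ∈ insert (0 : Site 2) unitSteps, |dWaveFormFactor e / Real.sqrt 2| ≤
      4 * (1 / Real.sqrt 2) := by
    rw [Finset.sum_insert_of_eq_zero_if_notMem (fun _ => by simp)]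
    calc ∑ e ∈ unitSteps, |dWaveFormFactor e / Real.sqrt 2|
        ≤ ∑ _e ∈ unitSteps, 1 / Real.sqrt 2 := by
          refine Finset.sum_le_sum fun e _ => ?_
          rw [abs_div, abs_of_pos hs2]
          have habs : |dWaveFormFactor e| ≤ 1 := by unfold dWaveFormFactor; split_ifs <;> simp
          exact div_le_div_of_nonneg_right habs hs2.le
      _ = (unitSteps.card : ℝ) * (1 / Real.sqrt 2) := by rw [Finset.sum_const, nsmul_eq_mul]
      _ ≤ 4 * (1 / Real.sqrt 2) := by
          refine mul_le_mul_of_nonneg_right ?_ (by positivity)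
          have : unitSteps.card ≤ 4 := by
            unfold unitSteps
            exact (Finset.card_insert_le _ _).trans (Nat.succ_le_succ ((Finset.card_insert_le _ _).trans
              (Nat.succ_le_succ ((Finset.card_insert_le _ _).trans (Nat.succ_le_succ (by simp))))))
          exact_mod_cast this
  have h0 : 0 ≤ ∑ e ∈ insert (0 : Site 2) unitSteps, |dWaveFormFactor e / Real.sqrt 2| :=
    Finset.sum_nonneg fun e _ => abs_nonneg _
  have hsq : Real.sqrt 2 ^ 2 = 2 := Real.sq_sqrt (by norm_num)
  calc (2 * ∑ e ∈ insert (0 : Site 2) unitSteps, |dWaveFormFactor e / Real.sqrt 2|) ^ 2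
      ≤ (2 * (4 * (1 / Real.sqrt 2))) ^ 2 :=
        pow_le_pow_left₀ (by positivity) (mul_le_mul_of_nonneg_left hsum (by norm_num)) 2
    _ = 64 / Real.sqrt 2 ^ 2 := by field_simp; ring
    _ = 32 := by rw [hsq]; norm_num

/-- **(a) for d-wave**: `re ⟨φ, Δ_dᴴ Δ_d φ⟩ ≤ 32 L² N_↓ ‖φ‖²` on every sector. [folklore] -/
theorem re_expect_dWave_le_minority {a b : ℕ} {φ : Fock (Orb (FermionTorus 2 L))}
    (hφ : IsInSector a b φ) :
    (star φ ⬝ᵥ ((pairField dWaveFormFactor L)ᴴ * pairField dWaveFormFactor L) *ᵥ φ).re ≤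
      32 * (L : ℝ) ^ 2 * b * (star φ ⬝ᵥ φ).re := by
  refine (re_expect_pairField_le_minority dWaveFormFactor hφ).trans ?_
  have h0 : 0 ≤ (L : ℝ) ^ 2 * b * (star φ ⬝ᵥ φ).re := by
    have := enorm_sq_eq_re φ
    have h1 : 0 ≤ (star φ ⬝ᵥ φ).re := by rw [← this]; positivity
    positivity
  calc _ = (2 * ∑ e ∈ insert (0 : Site 2) unitSteps, |dWaveFormFactor e / Real.sqrt 2|) ^ 2 *
        ((L : ℝ) ^ 2 * b * (star φ ⬝ᵥ φ).re) := by ring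
    _ ≤ 32 * ((L : ℝ) ^ 2 * b * (star φ ⬝ᵥ φ).re) := mul_le_mul_of_nonneg_right dWave_coupling_sq_le h0
    _ = _ := by ring

end Minority

end Summit.HubbardSuperconductivity.HubbardSuperconductivity.Theorems.SpinPolarization
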